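import Literature.AlgebraicGeometry.AbelianSchemes.SerreTensorModuleMap
import Literature.Algebra.Module.IdempotentPresentation
import HarnessLib

/-!
# Quasi-inverse module maps induce quasi-inverse homomorphisms: `(A ⊗ ψ) ∘ (A ⊗ φ) = ι(a)` when `ψ ∘ φ = a · id`

Topic `AlgebraicGeometry/AbelianSchemes`, namespace `Literature.AlgebraicGeometry.AbelianSchemes.AbelianSchemeOver` (proved theorems about
the ★ constructions `serrePresentationHom` (FILE 5∕7) and `presMatrix` (★ `Algebra/Module/IdempotentPresentation`); no definition, no named
fact, no `sorry`, no `instance`, no notation; any base `S`).  Cell `hodgecm-mathlib`, F0/P6 «MOD», P6a organ (g2) FILE 13;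
`--supports stmt-HodgeConjecture-24832`, count-neutral.  HC_CM is proved only modulo the 2 remaining named inputs (hLiu418, h413) until
rung 0 closes; this file discharges none of them.

## Mathematics

For `𝒪`-linear maps `φ : 𝔞 → 𝔞′`, `ψ : 𝔞′ → 𝔞` of finite projective `𝒪`-modules with `ψ ∘ φ = a · id_𝔞` (e.g. an inclusion of
invertible ideals `𝔞 ⊂ 𝔟` and `a ∈ 𝒪` with `a𝔟 ⊂ 𝔞`), functoriality and additivity of `M ↦ A ⊗_𝒪 M` give
`(A ⊗ ψ) ∘ (A ⊗ φ) = A ⊗ (a · id) = ι_{A ⊗ 𝔞}(a)`, the `a`-multiplication of the induced action: the two homomorphisms are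
quasi-inverse to each other up to `ι(a)` (B. Conrad, *Gross–Zagier revisited* §7, proof of Thm. 7.5: `M ⊗ A → N ⊗ A` is an isogeny
for an injection `M ↪ N` of finite index).  On presentations `𝔞 = E·𝒪ⁿ`: the matrix of `a · id` is `a·E = (a·1ₙ) E`, and
`A ⊗ (a·1ₙ E) = ι(a)` on `Fix([E])`.

## Contents

* `intertwines_scalar_mul_self`, **`serrePresentationHom_scalar_mul_self : A ⊗ ((a·1) E) = (serreAction act E hE).i a`**,
  `serrePresentationHom_smul_self` (`a • E`), **`serrePresentationHom_comp_of_quasiInverse`** (`Q P = (a·1) E ⇒ (A ⊗ P) ≫ (A ⊗ Q) = ι(a)`),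
  `presMatrix_comp_of_smul_id` (`ψ ∘ φ = a • id ⇒ P(ψ) P(φ) = a • E`),
  **`serrePresentationHom_presMatrix_comp_of_smul_id`** (the same for actual module maps `φ`, `ψ`).

## References
* [Conrad2004GrossZagier] B. Conrad, *Gross–Zagier revisited*, MSRI Publ. 49 (2004), §7 (Thm. 7.5 and its proof).
* [Kottwitz1992] §5 (p. 390).
-/

noncomputable section

universe u

open CategoryTheory CategoryTheory.Limits AlgebraicGeometry MonoidalCategory CartesianMonoidalCategory
open scoped MonObj

namespace Literature.AlgebraicGeometry.AbelianSchemes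

namespace AbelianSchemeOver

open Literature.Algebra.Module.IdempotentMatrix

variable {S : Scheme.{u}} {A : AbelianSchemeOver S} {O : Type*} [CommRing O] (act : A.RingAction O) [IsCommMonObj A.X]
  {m n : ℕ} (E : Matrix (Fin n) (Fin n) O) (hE : E * E = E) (E' : Matrix (Fin m) (Fin m) O) (hE' : E' * E' = E')

/-- `a • E = (a·1ₙ) E`. [cite: Kottwitz1992, §5 (p. 390)] -/
theorem smul_eq_scalar_mul (a : O) : a • E = Matrix.scalar (Fin n) a * E := by
  rw [Matrix.scalar_apply, ← Matrix.smul_eq_diagonal_mul]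

/-- `(a·1) E` intertwines `E` with itself: `E ((a·1) E) = ((a·1) E) E`. [cite: Kottwitz1992, §5 (p. 390)] -/
theorem intertwines_scalar_mul_self (a : O) : E * (Matrix.scalar (Fin n) a * E) = Matrix.scalar (Fin n) a * E * E := by
  rw [← Matrix.mul_assoc, ← (Matrix.scalar_commute a (fun r' => Commute.all a r') E).eq]

/-- **`A ⊗ ((a·1ₙ) E) = ι(a)`**: the module endomorphism `a · id` of `𝔞 = E·𝒪ⁿ` induces the `a`-multiplication of `A ⊗_𝒪 𝔞`.
[cite: Conrad2004GrossZagier, §7] -/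
theorem serrePresentationHom_scalar_mul_self (a : O) :
    serrePresentationHom act E hE E hE (Matrix.scalar (Fin n) a * E) = (serreAction act E hE).i a := by
  haveI := (isMonHom_serreι_serreπ act E hE).2.2
  rw [← cancel_mono (serreι act E hE), serrePresentationHom_ι_of act E hE E hE _ (intertwines_scalar_mul_self E a),
    serreAction_i_comp_ι, matrixHom_mul, matrixHom_square, matrixHom_square, serreι_comp_matrixEnd_assoc]

/-- The same with `a • E`. [cite: Conrad2004GrossZagier, §7] -/
theorem serrePresentationHom_smul_self (a : O) : serrePresentationHom act E hE E hE (a • E) = (serreAction act E hE).i a := by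
  rw [smul_eq_scalar_mul, serrePresentationHom_scalar_mul_self]

/-- **Quasi-inverse intertwiners induce quasi-inverse homomorphisms**: if `E′P = PE`, `EQ = QE′` and `Q P = (a·1) E`, then
`(A ⊗ P) ≫ (A ⊗ Q) = ι(a)` on `A ⊗_𝒪 𝔞`. [cite: Conrad2004GrossZagier, §7] -/
theorem serrePresentationHom_comp_of_quasiInverse (P : Matrix (Fin m) (Fin n) O) (Q : Matrix (Fin n) (Fin m) O) {a : O}
    (hP : E' * P = P * E) (hQ : E * Q = Q * E') (hQP : Q * P = Matrix.scalar (Fin n) a * E) :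
    serrePresentationHom act E hE E' hE' P ≫ serrePresentationHom act E' hE' E hE Q = (serreAction act E hE).i a := by
  rw [serrePresentationHom_comp_of act E hE E' hE' E hE P hP Q hQ, hQP, serrePresentationHom_scalar_mul_self]

include hE' in
/-- On the module side: `ψ ∘ φ = a • id ⇒ P(ψ) P(φ) = a • E`. [cite: Conrad2004GrossZagier, §7] -/
theorem presMatrix_comp_of_smul_id (φ : LinearMap.range (Matrix.toLin' E) →ₗ[O] LinearMap.range (Matrix.toLin' E'))
    (ψ : LinearMap.range (Matrix.toLin' E') →ₗ[O] LinearMap.range (Matrix.toLin' E)) {a : O} (h : ψ ∘ₗ φ = a • LinearMap.id) :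
    presMatrix E' E ψ * presMatrix E E' φ = a • E := by
  rw [← presMatrix_comp E E φ hE' ψ, h, presMatrix_smul, presMatrix_id]

/-- **`ψ ∘ φ = a · id ⇒ (A ⊗ φ) ≫ (A ⊗ ψ) = ι(a)`** for actual module maps `φ : 𝔞 → 𝔞′`, `ψ : 𝔞′ → 𝔞` between presented modules
(`A ⊗ φ := serrePresentationHom (presMatrix φ)`). [cite: Conrad2004GrossZagier, §7] -/
theorem serrePresentationHom_presMatrix_comp_of_smul_id
    (φ : LinearMap.range (Matrix.toLin' E) →ₗ[O] LinearMap.range (Matrix.toLin' E'))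
    (ψ : LinearMap.range (Matrix.toLin' E') →ₗ[O] LinearMap.range (Matrix.toLin' E)) {a : O} (h : ψ ∘ₗ φ = a • LinearMap.id) :
    serrePresentationHom act E hE E' hE' (presMatrix E E' φ) ≫ serrePresentationHom act E' hE' E hE (presMatrix E' E ψ) =
      (serreAction act E hE).i a :=
  serrePresentationHom_comp_of_quasiInverse act E hE E' hE' (presMatrix E E' φ) (presMatrix E' E ψ)
    (presMatrix_intertwines φ hE hE') (presMatrix_intertwines ψ hE' hE)
    (by rw [presMatrix_comp_of_smul_id E E' hE' φ ψ h, smul_eq_scalar_mul])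

end AbelianSchemeOver

end Literature.AlgebraicGeometry.AbelianSchemes

end
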